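import Literature.NumberTheory.GaloisRepresentations.SerreTorusNormalizerGL2Fp
import Literature.NumberTheory.GaloisRepresentations.SerreSubgroupsGL2FpPrimeToP
import Literature.NumberTheory.GaloisRepresentations.SerreCartanNormalizerGL2Fp
import HarnessLib

/-!
# An odd irreducible subgroup of `GL₂(𝔽_p)` of order prime to `p` contains a non-trivial scalar

Topic `NumberTheory/GaloisRepresentations`; theorems only, a sequel to `SerreSubgroupsGL2FpPrimeToP`
and `SerreTorusNormalizerGL2Fp` (Serre, Invent. Math. 15 (1972), §2.6) and the group-theoretic core
of the cell memo `pub/bsd-smallim/koly/KOLY-MEMO.md`, Lemma 2.3 (a):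
**`Serre1972.exists_mat_eq_smul_one_ne_one`** — for `p ≥ 5`, a subgroup `G ≤ GL₂(𝔽_p)` of order
prime to `p` with surjective determinant, no common eigenvector, and an involution of determinant
`-1` contains a scalar `a·1`, `a ≠ 1`. (For `G = ρ̄_{E,p}(Γ_ℚ)`, `E[p]` irreducible, `ρ̄` not
surjective, the Teichmüller lift of `a·1` kills `H¹(ℚ(E[p^∞])/ℚ, E[p^k])` (Sah): Mazur–Rubin's
(H.3), Howard's H.2, and the Castella–Grossi–Lee–Skinner error term `C₁ = 0` become automatic.)
Proof by Serre's trichotomy `comm_or_exists_card_le_or_card_eq`: (i) `G` abelian would fix a line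
(the involution); (ii) a torus `T = C_G(x)` of index `2`: some `g ∉ T` has `(det g)² ≠ 1` (else
`det G ⊆ {±1} ∌ 2`), `g` normalises `𝔽_p[x]ˣ` without lying in it, so `g² = a·1` (n° 2.2) with
`a² = (det g)² ≠ 1`; (iii) `[G:Z] ∈ {12,24,60}`, centralisers `≤ 5|Z|`: a non-trivial central
element of the non-abelian `G` is a scalar, and `Z = 1` is impossible
(`false_of_center_trivial_of_card_eq`: an element of determinant of order `p-1` has order `≤ 5`, so
`p = 5`, `|G ∩ SL₂| = 3` is odd as `-1 ∉ G`, `|G| = 12`, and the square of an element of order `4`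
centralises `G ∩ SL₂ = ⟨x⟩`, giving `|C_G(x)| ≥ 6`).

## References

* [Serre1972] J.-P. Serre, Invent. Math. 15 (1972) 259–331, §2.2, §2.4 Prop. 15, §2.6.
* [CastellaGrossiLeeSkinner2022] F. Castella, G. Grossi, J. Lee, C. Skinner, Invent. Math. 227
  (2022), §3.3 (the error term `C₁`).
-/

open Matrix
open Matrix

namespace Literature.NumberTheory.GaloisRepresentations.Serre1972

open DeligneSerre1974 DeligneSerre1974.TwoByTwo

variable {p : ℕ} [Fact p.Prime]

/-- An involution of determinant `1` in `GL₂(𝔽_p)`, `p` odd, is `±1` (Cayley–Hamilton: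
`g² = tr(g)·g - 1`, so `tr(g)·g = 2` and `g` is a scalar of square `1`). [folklore] -/
private theorem mat_eq_one_or_eq_neg_one_of_mul_self_eq_one {G : Subgroup (GL (Fin 2) (ZMod p))}
    (hp2 : p ≠ 2) {g : G} (hg : g * g = 1) (hdet : (g.1.1).det = 1) :
    g.1.1 = 1 ∨ g.1.1 = -1 := by
  have h2 : (2 : ZMod p) ≠ 0 := two_ne_zero_of_ne_two hp2
  set M := g.1.1 with hM
  have hMM : M * M = 1 := by rw [hM, ← mat_mul, hg, mat_one]
  have hCH := mul_self_eq M
  rw [hMM, hdet, one_smul] at hCH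
  have htr : M.trace • M = (2 : ZMod p) • (1 : Matrix (Fin 2) (Fin 2) (ZMod p)) := by
    rw [two_smul]
    calc M.trace • M = M.trace • M - 1 + 1 := by abel
      _ = 1 + 1 := by rw [← hCH]
  have ht : M.trace ≠ 0 := by
    intro ht
    rw [ht, zero_smul] at htr
    have h00 := congrArg (fun A : Matrix (Fin 2) (Fin 2) (ZMod p) ↦ A 0 0) htr
    simp only [Matrix.zero_apply, Matrix.smul_apply, Matrix.one_apply_eq, smul_eq_mul, mul_one]
      at h00
    exact h2 h00.symm
  set a : ZMod p := (M.trace)⁻¹ * 2 with ha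
  have hMa : M = a • (1 : Matrix (Fin 2) (Fin 2) (ZMod p)) := by
    have := congrArg (fun A : Matrix (Fin 2) (Fin 2) (ZMod p) ↦ (M.trace)⁻¹ • A) htr
    simp only [smul_smul, inv_mul_cancel₀ ht, one_smul] at this
    rw [this, ha]
  have ha2 : a * a = 1 := by
    have hd : M.det = a * a := by
      rw [hMa, Matrix.det_smul, Matrix.det_one, mul_one, Fintype.card_fin, pow_two]
    rw [← hd, hdet]
  have ha' : a = 1 ∨ a = -1 := by
    have : (a - 1) * (a + 1) = 0 := by linear_combination ha2
    rcases mul_eq_zero.mp this with h | h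
    · exact Or.inl (by linear_combination h)
    · exact Or.inr (by linear_combination h)
  rcases ha' with h | h
  · left; rw [hMa, h, one_smul]
  · right; rw [hMa, h, neg_smul, one_smul]

/-- In case iii) of Serre's n° 2.6 trichotomy (`[G : Z] ∈ {12, 24, 60}`, centralisers of
non-central elements of order `≤ 5|Z|`) with `-1 ∉ G` and surjective determinant (`p ≥ 5`), the
centre cannot be trivial: an element whose determinant has order `p - 1` has order `≤ 5`, so
`p = 5`; then `G ∩ SL₂` has odd order (an involution of determinant `1` is `±1`), hence order `3`,
`|G| = 12`, and the square of an element `y` of order `4` centralises the normal subgroup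
`G ∩ SL₂ = ⟨x⟩`, so `|C_G(x)| ≥ 6 > 5`. [cite: Serre1972, §2.6] -/
theorem false_of_center_trivial_of_card_eq {G : Subgroup (GL (Fin 2) (ZMod p))} (hp5 : 5 ≤ p)
    (hG : ¬ p ∣ Nat.card G)
    (hdet : ∀ u : (ZMod p)ˣ, ∃ g ∈ G, Matrix.GeneralLinearGroup.det g = u)
    (hneg : ∀ z : G, z.1.1 ≠ -1)
    (hZ : ∀ z : G, z ∈ Subgroup.center G → z = 1)
    (h12 : Nat.card G = 12 * Nat.card (Subgroup.center G) ∨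
        Nat.card G = 24 * Nat.card (Subgroup.center G) ∨
        Nat.card G = 60 * Nat.card (Subgroup.center G))
    (h5 : ∀ x : G, x ∉ Subgroup.center G →
        Nat.card (Subgroup.centralizer ({x} : Set G)) ≤ 5 * Nat.card (Subgroup.center G)) :
    False := by
  classical
  have hprime : p.Prime := Fact.out
  have hp2 : p ≠ 2 := by omega
  have hZbot : Subgroup.center G = ⊥ := (Subgroup.eq_bot_iff_forall _).mpr hZ
  have hZ1 : Nat.card (Subgroup.center G) = 1 := by rw [hZbot, Subgroup.card_bot]
  rw [hZ1, mul_one, mul_one, mul_one] at h12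
  have h5' : ∀ x : G, x ≠ 1 → Nat.card (Subgroup.centralizer ({x} : Set G)) ≤ 5 := by
    intro x hx
    have := h5 x (by rw [hZbot, Subgroup.mem_bot]; exact hx)
    rwa [hZ1, mul_one] at this
  have hord : ∀ x : G, x ≠ 1 → orderOf x ≤ 5 := by
    intro x hx
    have hle : Subgroup.zpowers x ≤ Subgroup.centralizer ({x} : Set G) := by
      rw [Subgroup.zpowers_le, Subgroup.mem_centralizer_singleton_iff]
    calc orderOf x = Nat.card (Subgroup.zpowers x) := (Nat.card_zpowers x).symm
      _ ≤ Nat.card (Subgroup.centralizer ({x} : Set G)) := Subgroup.card_le_of_le hle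
      _ ≤ 5 := h5' x hx
  obtain ⟨u, hu⟩ := IsCyclic.exists_generator (α := (ZMod p)ˣ)
  have hou : orderOf u = p - 1 := by
    rw [orderOf_eq_card_of_forall_mem_zpowers hu, Nat.card_units, Nat.card_zmod]
  obtain ⟨y₀, hy₀G, hy₀⟩ := hdet u
  set y : G := ⟨y₀, hy₀G⟩ with hy
  have hdvd : p - 1 ∣ orderOf y := by
    rw [← hou, ← hy₀, ← Subgroup.orderOf_coe y]
    exact orderOf_map_dvd (Matrix.GeneralLinearGroup.det) y₀
  have hy1 : y ≠ 1 := by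
    intro h
    have : orderOf y = 1 := by rw [h, orderOf_one]
    rw [this, Nat.dvd_one] at hdvd
    omega
  have hoy : orderOf y ≤ 5 := hord y hy1
  have hoypos : 0 < orderOf y := orderOf_pos y
  have hp : p = 5 := by
    have hle : p - 1 ≤ orderOf y := Nat.le_of_dvd hoypos hdvd
    have hp6 : p ≤ 6 := by omega
    rcases Nat.lt_or_ge p 6 with h | h
    · omega
    · exfalso
      have : p = 6 := by omega
      rw [this] at hprime
      exact absurd hprime (by decide)
  subst hp
  have hcard : Nat.card G = 12 ∨ Nat.card G = 24 := by
    rcases h12 with h | h | h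
    · exact Or.inl h
    · exact Or.inr h
    · exfalso; exact hG ⟨12, by rw [h]⟩
  set dG : G →* (ZMod 5)ˣ := (Matrix.GeneralLinearGroup.det).comp G.subtype with hdG
  have hrange : dG.range = ⊤ := by
    rw [MonoidHom.range_eq_top]
    intro v
    obtain ⟨g, hgG, hg⟩ := hdet v
    exact ⟨⟨g, hgG⟩, hg⟩
  have hidx : dG.ker.index = 4 := by
    rw [Subgroup.index_ker, hrange, Subgroup.card_top, Nat.card_units, Nat.card_zmod]
  have hmul : Nat.card dG.ker * 4 = Nat.card G := by rw [← hidx]; exact dG.ker.card_mul_index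
  have hker_odd : ¬ 2 ∣ Nat.card dG.ker := by
    intro h2
    obtain ⟨k, hk⟩ := exists_prime_orderOf_dvd_card' 2 h2
    have hk' : orderOf (k : G) = 2 := by rw [Subgroup.orderOf_coe]; exact hk
    have hk2 : (k : G) * (k : G) = 1 := by
      have h := pow_orderOf_eq_one (k : G)
      rw [hk', pow_two] at h
      exact h
    have hkdet : ((k : G).1.1).det = 1 := by
      have hmem : Matrix.GeneralLinearGroup.det ((k : G) : GL (Fin 2) (ZMod 5)) = 1 := k.2
      have := congrArg (fun v : (ZMod 5)ˣ ↦ (v : ZMod 5)) hmem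
      simpa only [Matrix.GeneralLinearGroup.val_det_apply, Units.val_one] using this
    rcases mat_eq_one_or_eq_neg_one_of_mul_self_eq_one hp2 hk2 hkdet with h | h
    · have hk1 : (k : G) = 1 := mat_injective (by rw [h, mat_one])
      rw [hk1, orderOf_one] at hk'
      omega
    · exact hneg (k : G) h
  have hker3 : Nat.card dG.ker = 3 := by
    rcases hcard with h | h <;> rw [h] at hmul <;> omega
  have hG12 : Nat.card G = 12 := by omega
  obtain ⟨k₃, hk₃⟩ := exists_prime_orderOf_dvd_card' (G := dG.ker) 3 (by rw [hker3])
  set x : G := (k₃ : G) with hx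
  have hox : orderOf x = 3 := by rw [hx, Subgroup.orderOf_coe, hk₃]
  have hx1 : x ≠ 1 := by
    intro h; rw [h, orderOf_one] at hox; omega
  have hker_eq : dG.ker = Subgroup.zpowers x := by
    symm
    apply Subgroup.eq_of_le_of_card_ge
    · rw [Subgroup.zpowers_le]; exact k₃.2
    · rw [Nat.card_zpowers, hox, hker3]
  have hoy4 : orderOf y = 4 := by
    have h4 : 4 ∣ orderOf y := by simpa using hdvd
    omega
  have hconj_ker : y * x * y⁻¹ ∈ dG.ker := (MonoidHom.normal_ker dG).conj_mem x k₃.2 y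
  rw [hker_eq] at hconj_ker
  obtain ⟨m, hm⟩ := Subgroup.mem_zpowers_iff.mp hconj_ker
  have hm' : x ^ (m % 3) = y * x * y⁻¹ := by
    have h3 : (3 : ℤ) = (orderOf x : ℤ) := by rw [hox]; norm_num
    rw [h3, zpow_mod_orderOf, hm]
  have hx3 : x ^ (3 : ℕ) = 1 := by rw [← hox, pow_orderOf_eq_one]
  have hcomm : y ^ 2 * x = x * y ^ 2 := by
    have hm3 : m % 3 = 0 ∨ m % 3 = 1 ∨ m % 3 = 2 := by omega
    rcases hm3 with h0 | h1 | h2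
    · exfalso
      rw [h0, zpow_zero] at hm'
      apply hx1
      calc x = y⁻¹ * (y * x * y⁻¹) * y := by group
        _ = 1 := by rw [← hm']; group
    · rw [h1, zpow_one] at hm'
      have hyx : Commute y x := by
        change y * x = x * y
        calc y * x = (y * x * y⁻¹) * y := by group
          _ = x * y := by rw [← hm']
      exact (hyx.pow_left 2).eq
    · have h2' : x ^ (2 : ℕ) = y * x * y⁻¹ := by
        rw [← hm', h2]
        norm_cast
      have hyxy : y * x = x ^ 2 * y := by
        calc y * x = (y * x * y⁻¹) * y := by group
          _ = x ^ 2 * y := by rw [← h2']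
      have hx4 : x ^ 4 = x := by
        calc x ^ 4 = x ^ 3 * x := by rw [pow_succ]
          _ = x := by rw [hx3, one_mul]
      have hyx2 : y * x ^ 2 = x * y := by
        calc y * x ^ 2 = y * x * x := by rw [pow_two, ← mul_assoc]
          _ = x ^ 2 * y * x := by rw [hyxy]
          _ = x ^ 2 * (x ^ 2 * y) := by rw [mul_assoc, hyxy]
          _ = x ^ (2 + 2) * y := by rw [← mul_assoc, ← pow_add]
          _ = x * y := by rw [show (2 : ℕ) + 2 = 4 from rfl, hx4]
      calc y ^ 2 * x = y * (y * x) := by rw [pow_two, mul_assoc]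
        _ = y * (x ^ 2 * y) := by rw [hyxy]
        _ = y * x ^ 2 * y := by rw [← mul_assoc]
        _ = x * y * y := by rw [hyx2]
        _ = x * y ^ 2 := by rw [pow_two y, mul_assoc]
  have hoy2 : orderOf (y ^ 2) = 2 := by
    rw [orderOf_pow' y two_ne_zero, hoy4]
    decide
  have hcommute : Commute x (y ^ 2) := hcomm.symm
  have ho6 : orderOf (x * y ^ 2) = 6 := by
    rw [hcommute.orderOf_mul_eq_mul_orderOf_of_coprime (by rw [hox, hoy2]; decide), hox, hoy2]
  have hmemC : x * y ^ 2 ∈ Subgroup.centralizer ({x} : Set G) := by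
    rw [Subgroup.mem_centralizer_singleton_iff]
    calc x * y ^ 2 * x = x * (y ^ 2 * x) := by rw [mul_assoc]
      _ = x * (x * y ^ 2) := by rw [hcomm]
      _ = x * (x * y ^ 2) := rfl
  have h6 : 6 ∣ Nat.card (Subgroup.centralizer ({x} : Set G)) := by
    have := orderOf_dvd_natCard (⟨x * y ^ 2, hmemC⟩ : Subgroup.centralizer ({x} : Set G))
    rwa [← Subgroup.orderOf_coe, Subgroup.coe_mk, ho6] at this
  have hpos : 0 < Nat.card (Subgroup.centralizer ({x} : Set G)) := Nat.card_pos
  have := h5' x hx1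
  omega

/-- **Lemma 2.3 (a) of the cell memo (Serre 1972 §2.6, read for odd irreducible images): an
irreducible subgroup of `GL₂(𝔽_p)` (`p ≥ 5`) of order prime to `p`, with surjective determinant
and containing an involution of determinant `-1`, contains a non-trivial scalar.** For
`G = ρ̄_{E,p}(Γ_ℚ)` with `E[p]` irreducible and `ρ̄_{E,p}` not surjective (so `p ∤ #G` by
Prop. 15, `det = χ̄_p` onto, complex conjugation an involution of determinant `-1`) this is the
input that makes `C₁ = 0` and `H¹(ℚ(E[p^∞])/ℚ, E[p]) = 0` automatic (memo Lemma 2.3 (b)–(c)).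
[cite: Serre1972, §2.6 (trichotomy) and §2.2 (squares in `N ∖ C` are scalar)] -/
theorem exists_mat_eq_smul_one_ne_one (G : Subgroup (GL (Fin 2) (ZMod p))) (hp5 : 5 ≤ p)
    (hG : ¬ p ∣ Nat.card G)
    (hdet : ∀ u : (ZMod p)ˣ, ∃ g ∈ G, Matrix.GeneralLinearGroup.det g = u)
    (hirr : ∀ (v : Fin 2 → ZMod p) (hv : v ≠ 0), ¬ G ≤ eigenvectorStabilizer v hv)
    {c : GL (Fin 2) (ZMod p)} (hcG : c ∈ G) (hc : c * c = 1)
    (hdc : Matrix.det (c : Matrix (Fin 2) (Fin 2) (ZMod p)) = -1) :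
    ∃ z : G, ∃ a : ZMod p, a ≠ 1 ∧ z.1.1 = a • 1 := by
  classical
  have hprime : p.Prime := Fact.out
  have hp2 : p ≠ 2 := by omega
  have htwo : (2 : ZMod p) ≠ 0 := two_ne_zero_of_ne_two hp2
  have h41 : (2 : ZMod p) * 2 ≠ 1 := by
    intro h
    have h3 : ((3 : ℕ) : ZMod p) = 0 := by
      have : (2 : ZMod p) * 2 - 1 = 0 := sub_eq_zero.mpr h
      calc ((3 : ℕ) : ZMod p) = (2 : ZMod p) * 2 - 1 := by push_cast; ring
        _ = 0 := this
    rw [ZMod.natCast_eq_zero_iff] at h3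
    have := Nat.le_of_dvd (by norm_num) h3
    omega
  by_cases hneg : ∃ z : G, z.1.1 = -1
  · obtain ⟨z, hz⟩ := hneg
    refine ⟨z, -1, ?_, by rw [hz, neg_smul, one_smul]⟩
    intro h
    apply htwo
    calc (2 : ZMod p) = 1 - (-1) := by ring
      _ = 0 := by rw [h, sub_self]
  push Not at hneg
  rcases comm_or_exists_card_le_or_card_eq G hp2 hG with hab | ⟨x, hxZ, hidx⟩ | ⟨h12, h5⟩
  · -- (i) `G` abelian: `G ⊆ 𝔽_p[c]ˣ` fixes a line
    exfalso
    set y : G := ⟨c, hcG⟩ with hy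
    have hys : ∀ t : ZMod p, y.1.1 ≠ t • 1 := by
      intro t ht
      have hval : (c : Matrix (Fin 2) (Fin 2) (ZMod p)) = t • 1 := ht
      have hcc : (c : Matrix (Fin 2) (Fin 2) (ZMod p)) * c = 1 := by
        rw [← Units.val_mul, hc, Units.val_one]
      have ht2 : t * t = 1 := by
        have h00 := congrArg (fun M : Matrix (Fin 2) (Fin 2) (ZMod p) ↦ M 0 0) hcc
        simpa [hval, Matrix.smul_apply, Matrix.one_apply] using h00
      have hd : Matrix.det (c : Matrix (Fin 2) (Fin 2) (ZMod p)) = t * t := by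
        rw [hval, Matrix.det_smul, Matrix.det_one, mul_one, Fintype.card_fin, pow_two]
      rw [hd, ht2] at hdc
      apply htwo
      linear_combination hdc
    have hdisc : (y.1.1).trace ^ 2 - 4 * (y.1.1).det ≠ 0 :=
      disc_ne_zero_of_pow_eq_one htwo hys (det_mat_ne_zero y) (m := Nat.card G)
        (by rwa [Ne, ZMod.natCast_eq_zero_iff]) (by rw [← mat_pow, pow_card_eq_one', mat_one])
    have hC' := unitGroup_adjoinElem_mem_cartanSubgroups hys hdisc
    have hGC' : G ≤ unitGroup (adjoinElem y.1.1) := le_unitGroup_adjoinElem_of_comm hab hys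
    obtain ⟨v, hv, hB⟩ := exists_le_eigenvectorStabilizer_of_le_cartan hp2 hC' hGC' hcG hc hdc
    exact hirr v hv hB
  · -- (ii) a maximal torus `T = C_G(x)` of index `2`
    set T : Subgroup G := Subgroup.centralizer ({x} : Set G) with hT
    have hTn : T.Normal := normal_of_card_le_two_mul hidx
    have hsq : ∃ g : G, g ∉ T ∧
        Matrix.GeneralLinearGroup.det g.1 * Matrix.GeneralLinearGroup.det g.1 ≠ 1 := by
      by_contra hall
      push Not at hall
      obtain ⟨g₀, hg₀⟩ : ∃ g₀ : G, g₀ ∉ T := by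
        by_contra hall'
        push Not at hall'
        apply hxZ
        rw [Subgroup.mem_center_iff]
        intro g
        exact Subgroup.mem_centralizer_singleton_iff.mp (hall' g)
      have hallG : ∀ g : G,
          Matrix.GeneralLinearGroup.det g.1 * Matrix.GeneralLinearGroup.det g.1 = 1 := by
        intro g
        by_cases hgT : g ∈ T
        · have hprod : g₀ * g ∉ T := fun h ↦ hg₀ (by simpa using T.mul_mem h (T.inv_mem hgT))
          have h1 := hall (g₀ * g) hprod
          have h0 := hall g₀ hg₀
          have hmul : Matrix.GeneralLinearGroup.det (g₀ * g).1 =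
              Matrix.GeneralLinearGroup.det g₀.1 * Matrix.GeneralLinearGroup.det g.1 := by
            rw [Subgroup.coe_mul, map_mul]
          rw [hmul] at h1
          calc Matrix.GeneralLinearGroup.det g.1 * Matrix.GeneralLinearGroup.det g.1
              = (Matrix.GeneralLinearGroup.det g₀.1 * Matrix.GeneralLinearGroup.det g₀.1) *
                  (Matrix.GeneralLinearGroup.det g.1 * Matrix.GeneralLinearGroup.det g.1) := by
                rw [h0, one_mul]
            _ = (Matrix.GeneralLinearGroup.det g₀.1 * Matrix.GeneralLinearGroup.det g.1) *
                  (Matrix.GeneralLinearGroup.det g₀.1 * Matrix.GeneralLinearGroup.det g.1) := by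
                rw [mul_mul_mul_comm]
            _ = 1 := h1
        · exact hall g hgT
      obtain ⟨g2, hg2G, hg2⟩ := hdet (Units.mk0 (2 : ZMod p) htwo)
      have := hallG ⟨g2, hg2G⟩
      simp only [hg2] at this
      apply h41
      have := congrArg (fun v : (ZMod p)ˣ ↦ (v : ZMod p)) this
      simpa using this
    obtain ⟨g, hgT, hgsq⟩ := hsq
    obtain ⟨hxs, hdisc⟩ := nonscalar_of_not_mem_center htwo hG hxZ
    have hC' := unitGroup_adjoinElem_mem_cartanSubgroups hxs hdisc
    have hgN : (g : GL (Fin 2) (ZMod p)) ∈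
        Subgroup.normalizer (unitGroup (adjoinElem x.1.1) : Set (GL (Fin 2) (ZMod p))) := by
      apply map_normalizer_centralizer_le_normalizer (G := G) hxs
      refine ⟨g, ?_, rfl⟩
      rw [← hT, Subgroup.normalizer_eq_top_iff.mpr hTn]
      exact Subgroup.mem_top g
    have hgC : (g : GL (Fin 2) (ZMod p)) ∉ unitGroup (adjoinElem x.1.1) := by
      intro hmem
      apply hgT
      obtain ⟨a, b, hab'⟩ := mem_adjoinElem_iff.mp (mem_unitGroup_iff.mp hmem)
      rw [hT, Subgroup.mem_centralizer_singleton_iff, commute_iff_mat]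
      exact mul_eq_mul_of_eq_smul_one_add_smul hab' rfl
    obtain ⟨a, ha⟩ := sq_eq_smul_one_of_mem_normalizer hC' (fun _ ↦ hp2) hgN hgC
    refine ⟨g ^ 2, a, ?_, ?_⟩
    · intro ha1
      apply hgsq
      have hd : Matrix.det (((g : GL (Fin 2) (ZMod p)) ^ 2 : GL (Fin 2) (ZMod p)) :
          Matrix (Fin 2) (Fin 2) (ZMod p)) = a ^ 2 := by
        rw [ha, Matrix.det_smul, Matrix.det_one, mul_one, Fintype.card_fin]
      rw [ha1, one_pow, Units.val_pow_eq_pow_val, Matrix.det_pow] at hd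
      ext
      rw [Units.val_mul, Units.val_one, Matrix.GeneralLinearGroup.val_det_apply, ← pow_two, hd]
    · rw [mat_pow]
      rw [Units.val_pow_eq_pow_val] at ha
      exact ha
  · -- (iii) the exceptional numerology
    by_cases hZ : ∃ z : G, z ∈ Subgroup.center G ∧ z ≠ 1
    · obtain ⟨z, hz, hz1⟩ := hZ
      have hna : ¬ ∀ a b : G, a * b = b * a := by
        intro hab
        have htop : Subgroup.center G = ⊤ := by
          rw [eq_top_iff]
          intro g _
          rw [Subgroup.mem_center_iff]
          intro h
          exact hab h g
        rw [htop, Subgroup.card_top] at h12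
        have hpos : 0 < Nat.card G := Nat.card_pos
        omega
      obtain ⟨a, ha⟩ := exists_mat_eq_smul_one_of_mem_center hna hz
      refine ⟨z, a, ?_, ha⟩
      rintro rfl
      apply hz1
      apply mat_injective
      rw [ha, one_smul, mat_one]
    · push Not at hZ
      exfalso
      exact false_of_center_trivial_of_card_eq hp5 hG hdet hneg hZ h12 h5

end Literature.NumberTheory.GaloisRepresentations.Serre1972
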